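import Literature.NumberTheory.Sieve.FGKMT2018MultidimensionalSieve
import HarnessLib

/-!
# FGKMT 2018, Theorem 6 ∘ Lemma 7.2 — DECOMPOSITION into its two printed inputs

Source: K. Ford, B. Green, S. Konyagin, J. Maynard, T. Tao, *Long gaps between primes*, J. Amer.
Math. Soc. 31 (2018) 65–105 = arXiv:1412.5029v4 [FordGreenKonyaginMaynardTao2018], §7 pp. 20–22;
J. Maynard, *Dense clusters of primes in subsets*, Compositio Math. 152 (2016) 1517–1554 =
arXiv:1405.2593 [Maynard2016DenseClusters], Proposition 6.1 and Lemmas 8.1, 8.5, 8.6.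

The named fact `FordGreenKonyaginMaynardTao2018_theorem6ZN` (`FGKMT2018MultidimensionalSieve`) —
the last named input of the large-gaps DAG (`rankinConstant_of_fgkmt2018_theorem6ZN`) — is, as its
docstring says, Theorem 6 of [FGKMT] COMBINED with Lemma 7.2. In print these are two results with
disjoint proofs and disjoint toolkits:

* **Lemma 7.2** [FGKMT, p. 20; proof p. 21] — purely multiplicative number theory: the Landau–Page
  theorem with the exceptional prime removed (Lemma 7.1, Corollary 5) and the Bombieri–Vinogradov
  argument with the power saving `exp(−c√log x)` for moduli coprime to `B` ((7.4)) give Hypothesis 1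
  (Definition 2), part (2), for `𝒜 = ℤ`, `θ = 1/3`, every primitive linear form `L = a n + b`
  (`(a, b) = 1` — see the ERRATUM in the docstring of `…lemma72`: members of admissible families are
  primitive, and for imprimitive forms the statement is false) with
  `1 ≤ |a| ≤ log x`, `|b| ≤ x log² x`, `L ≥ 0` on `[y, 2y]`, `(a, B) = 1`, at every scale
  `y ≤ x log² x`, with ABSOLUTE implied constants and the exponent `100k²` for every `k ≤ log^{1/5} x`.
  Rendered below as `FordGreenKonyaginMaynardTao2018_lemma72` over the tree's `HypothesisOneZ`
  (parts (1), (3) of Hypothesis 1 concern `𝒜` only and are trivial for `𝒜 = ℤ`). The scale window is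
  stated from `x/2` (the printed lemma has `x ≤ y`; §8 applies it «with `x` replaced by `x/2`», and
  the proof — (7.4) holds for all `z ≤ x log⁴ x` — is uniform in `y ≤ x log² x`), exactly as in
  `…theorem6ZN` (typing remark (i) of `FGKMT2018MultidimensionalSieve`).
* **Theorem 6** [FGKMT, pp. 21–22] = [Maynard2016DenseClusters, Prop. 6.1 with Lemmas 8.1, 8.5(iii),
  8.6] — the uniform-in-`k` multidimensional Selberg sieve: GIVEN Hypothesis 1 at a subfamily `𝓛'`
  (here: at the single forms `L_i` for which (7.13) is claimed), the asymptotics (7.12)–(7.15) and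
  `𝔖_B(𝓛) ≥ e^{−Kk}`, with implied constants depending only on `θ, α` and on the Hypothesis-1
  constant. Rendered below, for `𝒜 = ℤ`, `𝒫` = all primes, `θ = 1/3`, as `Maynard2016DenseClusters_prop61Z`:
  the text of `…theorem6ZN` with the modulus `B` universally quantified (`B = 1` or prime, `B ≤ x`)
  instead of produced, and clause (7.13) for the form `L_i` guarded by the extra hypothesis
  `HypothesisOneZ (1/3) B k X (L i) C_H`; the whole statement is uniform over the Hypothesis-1
  constant `C_H > 0` (`∀ C_H, ∃ C K F I J, …`, [FGKMT, Thm 6: «all implied constants depend only on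
  θ, α and the implied constants in the bounds of Hypothesis 1»]).

`fgkmt2018_theorem6ZN_of_prop61Z_of_lemma72` PROVES `…lemma72 → …prop61Z → …theorem6ZN` (choose the
absolute constant `C_H` of Lemma 7.2, feed it to Proposition 6.1, and at each large `x` take the `B`
of Lemma 7.2; the guard of (7.13) is discharged by Lemma 7.2 since `L_i > R ≥ X^{1/30} > 0` on
`[X, 2X]` and `a_i ≠ 0`). So the single coarse input of the DAG is replaced by two finer, independently
attackable inputs whose proofs live in different parts of the library: Lemma 7.2 next to the tree's
Bombieri–Vinogradov / Page machinery (`bombieri_vinogradov_of_vaughan_of_siegelWalfisz`,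
`vaughan_meanValue_holds`, `PageUniformPNT.exists_exceptionalPrime`, `ExceptionalZeroPsi`), Prop. 6.1
next to the tree's Maynard–Tao files (`MaynardTao`, `MaynardTaoLargeKProofs`: `maynardI`, `maynardJ`,
the large-`k` test-function analysis) and the FGKMT §7 kit (`FGKMT2018SieveWeightsStructure`,
`FGKMT2018SingularSeriesExcl`).

## References
* K. Ford, B. Green, S. Konyagin, J. Maynard, T. Tao, *Long gaps between primes*, JAMS 31 (2018),
  §7: Definition 2, Lemma 7.1, Corollary 5, Lemma 7.2, Theorem 6 [FordGreenKonyaginMaynardTao2018].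
* J. Maynard, *Dense clusters of primes in subsets*, Compositio Math. 152 (2016) 1517–1554,
  Proposition 6.1, Lemmas 8.1, 8.5, 8.6, Propositions 9.1, 9.2, 9.4 [Maynard2016DenseClusters].
-/

noncomputable section

open Finset Filter

namespace Literature.NumberTheory.Sieve

open FGKMT2018

/-- Admissibility forces each form to be primitive: `(a_i, b_i) = 1` (a prime dividing both
`a_i` and `b_i` divides `L_i(n)` for every `n`, hence is a fixed prime divisor of `∏ L_j(n)`).
[cite: FordGreenKonyaginMaynardTao2018, §7 p. 20 (admissible sets of linear forms)] -/
theorem FGKMT2018.intGcd_eq_one_of_formsAdmissible {k : ℕ} {L : Fin k → ℤ × ℤ}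
    (h : FormsAdmissible L) (i : Fin k) : Int.gcd (L i).1 (L i).2 = 1 := by
  by_contra hne
  obtain ⟨p, hp, hpd⟩ := Nat.exists_prime_and_dvd hne
  obtain ⟨n, hn⟩ := h.2 p hp
  have h1 : (p : ℤ) ∣ (L i).1 := (Int.natCast_dvd_natCast.2 hpd).trans (Int.gcd_dvd_left _ _)
  have h2 : (p : ℤ) ∣ (L i).2 := (Int.natCast_dvd_natCast.2 hpd).trans (Int.gcd_dvd_right _ _)
  exact hn (((h1.mul_right n).add h2).trans
    (Finset.dvd_prod_of_mem (fun j => formEval (L j) n) (Finset.mem_univ i)))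

/-- **[FGKMT, Lemma 7.2]** (Hypothesis 1 for `𝒜 = ℤ`, `θ = 1/3`, via Landau–Page and the
Bombieri–Vinogradov argument with the exceptional prime removed). There is an absolute constant
`C_H` such that for all large `x` there is a natural number `B ≤ x`, equal to `1` or to a prime, with:
for every `k ≤ log^{1/5} x`, every PRIMITIVE linear form `L(n) = a n + b` — `(a, b) = 1` — with
`1 ≤ |a| ≤ log x`, `|b| ≤ x log² x`, every scale `x/2 ≤ y ≤ x log² x` such that `L ≥ 0` on
`𝒜(y) = [y, 2y]` and `(a, B) = 1`, part (2) of Hypothesis 1 holds at `L` with constant `C_H`: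
`∑_{q ≤ y^{1/3}, (q,B)=1} max_{(L(a),q)=1} |#𝒫_L(y; q, a) − #𝒫_L(y)/φ_L(q)| ≤ C_H #𝒫_L(y)/log^{100k²} y`
(`HypothesisOneZ (1/3) B k y L C_H`). The printed window is `x ≤ y ≤ x log² x`; §8 uses the lemma
«with `x` replaced by `x/2`» and its proof ((7.4): all `z ≤ x log⁴ x`) is uniform in `y ≤ x log² x`, so
the window is stated from `x/2` as in `FordGreenKonyaginMaynardTao2018_theorem6ZN`. Parts (1) and (3)
of Hypothesis 1 are statements about `𝒜 = ℤ` alone («easy», loc. cit.) and are not recorded. Inputs in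
print: Lemma 7.1 (Landau–Page), Corollary 5 (`B_Q` = a prime factor of the exceptional conductor; cf.
the tree's `PageUniformPNT.exists_exceptionalPrime`), the bound (7.4) for primitive characters of
modulus `< exp(2c√log x)` coprime to `B`, and «a standard proof of the Bombieri–Vinogradov Theorem»
(cf. `bombieri_vinogradov_of_vaughan_of_siegelWalfisz`).

**ERRATUM (2026-08-29).** The first rendering of this fact (2026-08-28) omitted the hypothesis
`Int.gcd l.1 l.2 = 1`, exactly as the printed Lemma 7.2 does — in print the lemma is only ever applied
(Theorem 6, §8) to members of ADMISSIBLE families, which are primitive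
(`FGKMT2018.intGcd_eq_one_of_formsAdmissible`), and Hypothesis 1 of [Maynard2016DenseClusters] is
stated for admissible `𝓛`. Without it the statement is FALSE: for `x = 2m` large, `y = m`, `k = 0`,
a prime `ℓ ∈ {2, 3}` with `ℓ ≠ B` and the form `L = (−ℓ, ℓ(2m+1))`, `L(n) = ℓ(2m+1−n)`, one has
`L ≥ ℓ > 0` on `[m, 2m]`, `|a| = ℓ ≤ log x`, `|b| ≤ x log² x`, `(ℓ, B) = 1`, and `L(n)` is prime
iff `n = 2m`, so `#𝒫_L(m) = 1` and the right-hand side is `C_H`; choosing the residues `a_q = 2m`,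
every prime `5 ≤ q ≤ m^{1/3}`, `q ≠ B`, has `(L(a_q), q) = (ℓ, q) = 1`, `#𝒫_L(m; q, a_q) = 1` and
`φ_L(q) = φ(ℓq)/φ(ℓ) = φ(q)`, contributing `1 − 1/φ(q) ≥ 3/4`; the left-hand side is therefore
`≥ (3/4)(π(m^{1/3}) − 4) → ∞`. (The degenerate forms are those with a fixed prime divisor: a single
prime value and residues `L(a_q)` that are units mod `q` but not mod `|a|q`.) No declaration used the
uncorrected text except `fgkmt2018_theorem6ZN_of_prop61Z_of_lemma72` below, re-proved unchanged in
statement (admissible families consist of primitive forms).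
[cite: FordGreenKonyaginMaynardTao2018, Lemma 7.2 p. 20, proof p. 21 ((7.4))] -/
def FordGreenKonyaginMaynardTao2018_lemma72 : Prop :=
  ∃ C_H : ℝ, 0 < C_H ∧ ∀ᶠ x : ℕ in atTop, ∃ B : ℕ, (B = 1 ∨ B.Prime) ∧ B ≤ x ∧
    ∀ (k : ℕ) (l : ℤ × ℤ) (y : ℝ), (k : ℝ) ≤ Real.log x ^ ((1 : ℝ) / 5) →
      l.1 ≠ 0 → Int.gcd l.1 l.2 = 1 → |((l.1 : ℤ) : ℝ)| ≤ Real.log x →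
      |((l.2 : ℤ) : ℝ)| ≤ x * Real.log x ^ 2 →
      (x : ℝ) / 2 ≤ y → y ≤ x * Real.log x ^ 2 →
      (∀ n ∈ dyadZ y, 0 ≤ formEval l n) → Nat.Coprime l.1.natAbs B →
      HypothesisOneZ ((1 : ℝ) / 3) B k y l C_H

/-- **[Maynard2016DenseClusters, Proposition 6.1] for `𝒜 = ℤ`, `𝒫` = all primes, `θ = 1/3`** (with Lemma
8.1(i) for `𝔖_B(𝓛) ≥ e^{−Kk}`, Lemma 8.5(iii) for the crude bound and Lemma 8.6 for `I_k`, `J_k`), in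
the form [FGKMT, Theorem 6] quotes it («a slightly modified form of Proposition 6.1»; Hypothesis 1
assumed at a subfamily `𝓛'` only): for every Hypothesis-1 constant `C_H > 0` there are a threshold
`C`, a constant `K > 0`, functions `F_k : ℝ^k → ℝ` and reals `I_k, J_k` (`k ≥ C`) with
`(2k log k)^{-k} ≤ K I_k`, `(log k/k) I_k ≤ K J_k`, `J_k ≤ K (log k/k) I_k`, such that for every
`ε > 0`, all large `x`, EVERY `B ≤ x` equal to `1` or a prime, all admissible non-degenerate
`𝓛 = (L_1,…,L_k)` with `C ≤ k ≤ log^{1/5} x`, `|a_i| ≤ log x`, `|b_i| ≤ x log² x`, all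
`x/2 ≤ X ≤ x log² x`, `X^{1/30} ≤ R ≤ X^{1/9}`, with `w = w_{k,𝓛,B,R}` built from `F_k`:
`𝔖_B(𝓛) ≥ e^{−Kk}`; (7.12); (7.13) for every `i` with `(a_i, B) = 1`, `L_i > R` on `𝒜(X)` AND
`HypothesisOneZ (1/3) B k X L_i C_H`; (7.14); (7.15) — i.e. the text of
`FordGreenKonyaginMaynardTao2018_theorem6ZN` with `B` universally quantified and (7.13) conditional on
Hypothesis 1 (2) at `L_i` (parts (1), (3) of Hypothesis 1 hold trivially for `𝒜 = ℤ`: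
`#𝒜(X; q, a) = #𝒜(X)/q + O(1)`). Maynard's hypotheses `|a_i|, |b_i| ≤ x^α`, `k ≤ (log x)^α`,
`B ≤ x^α`, `x^{θ/10} ≤ R ≤ x^{θ/3}` are met with `α = 2`, `θ = 1/3` at the scale `X`.
[cite: Maynard2016DenseClusters, Prop. 6.1, Lemmas 8.1, 8.5(iii), 8.6; FordGreenKonyaginMaynardTao2018, Thm 6 pp. 21–22 («given by [maynard-dense]»)] -/
def Maynard2016DenseClusters_prop61Z : Prop :=
  ∀ C_H : ℝ, 0 < C_H →
  ∃ (C : ℕ) (K : ℝ) (F : (k : ℕ) → (Fin k → ℝ) → ℝ) (I J : ℕ → ℝ), 0 < K ∧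
    (∀ k : ℕ, C ≤ k →
      0 < I k ∧ (2 * (k : ℝ) * Real.log k) ^ (-(k : ℝ)) ≤ K * I k ∧
        Real.log k / k * I k ≤ K * J k ∧ J k ≤ K * (Real.log k / k * I k)) ∧
    ∀ ε : ℝ, 0 < ε → ∀ᶠ x : ℕ in atTop, ∀ B : ℕ, (B = 1 ∨ B.Prime) → B ≤ x →
      ∀ (k : ℕ) (L : Fin k → ℤ × ℤ) (X R : ℝ), C ≤ k → (k : ℝ) ≤ Real.log x ^ ((1 : ℝ) / 5) →
        FormsAdmissible L → FormsNondegenerate L →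
        (∀ i, |(((L i).1 : ℤ) : ℝ)| ≤ Real.log x ∧ |(((L i).2 : ℤ) : ℝ)| ≤ x * Real.log x ^ 2) →
        (x : ℝ) / 2 ≤ X → X ≤ x * Real.log x ^ 2 →
        X ^ ((1 : ℝ) / 30) ≤ R → R ≤ X ^ ((1 : ℝ) / 9) →
        Real.exp (-(K * k)) ≤ singSeriesExcl L B ∧
        |∑ n ∈ dyadZ X, sieveWt L B R (F k) n - mainTermA L B X R (I k)|
            ≤ K / Real.log X ^ ((1 : ℝ) / 10) * mainTermA L B X R (I k) ∧
        (∀ i : Fin k, Nat.Coprime (L i).1.natAbs B → (∀ n ∈ dyadZ X, R < (formEval (L i) n : ℝ)) →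
          HypothesisOneZ ((1 : ℝ) / 3) B k X (L i) C_H →
          |∑ n ∈ (dyadZ X).filter (fun n => 0 < formEval (L i) n ∧ (formEval (L i) n).natAbs.Prime),
                sieveWt L B R (F k) n - mainTermB L B X R (J k) i|
            ≤ K / Real.log X ^ ((1 : ℝ) / 10) * mainTermB L B X R (J k) i
                + K * errTermB L B X R (I k)) ∧
        (∀ l₀ : ℤ × ℤ, l₀.1 ≠ 0 → |((l₀.1 : ℤ) : ℝ)| ≤ X ^ 2 → |((l₀.2 : ℤ) : ℝ)| ≤ X ^ 2 →
          (∀ j, l₀.1 * (L j).2 - (L j).1 * l₀.2 ≠ 0) →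
          ∑ n ∈ (dyadZ X).filter (fun n => 0 < formEval l₀ n ∧ (formEval l₀ n).natAbs.Prime ∧
              X ^ ((1 : ℝ) / 30) < (formEval l₀ n : ℝ)), sieveWt L B R (F k) n
            ≤ K * ((discDelta L l₀ : ℝ) / Nat.totient (discDelta L l₀)) * errTermB L B X R (I k)) ∧
        (∀ n : ℤ, sieveWt L B R (F k) n ≤ X ^ ((2 : ℝ) / 9 + ε))

/-- **Theorem 6 ∘ Lemma 7.2 from its two printed inputs**: [Maynard2016DenseClusters, Prop. 6.1] (for
`𝒜 = ℤ`) and [FGKMT, Lemma 7.2] imply `FordGreenKonyaginMaynardTao2018_theorem6ZN`. Proof: take the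
absolute constant `C_H` of Lemma 7.2, the data `C, K, F, I, J` of Proposition 6.1 at `C_H`; for large
`x` take the modulus `B = B(x)` of Lemma 7.2; clause (7.13) for `L_i` needs Hypothesis 1 (2) at
`L_i`, scale `X`, which Lemma 7.2 supplies because `a_i ≠ 0` and `(a_i, b_i) = 1` (admissibility,
`FGKMT2018.intGcd_eq_one_of_formsAdmissible`), `|a_i| ≤ log x`,
`|b_i| ≤ x log² x`, `x/2 ≤ X ≤ x log² x`, `(a_i, B) = 1` and `L_i > R ≥ X^{1/30} ≥ 0` on `𝒜(X)`.
[cite: FordGreenKonyaginMaynardTao2018, §8 p. 22 («applying Theorem 6 … using Lemma 7.2 to obtain Hypothesis 1»)] -/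
theorem fgkmt2018_theorem6ZN_of_prop61Z_of_lemma72 (h72 : FordGreenKonyaginMaynardTao2018_lemma72)
    (h61 : Maynard2016DenseClusters_prop61Z) : FordGreenKonyaginMaynardTao2018_theorem6ZN := by
  obtain ⟨C_H, hCH, h72'⟩ := h72
  obtain ⟨C, K, F, I, J, hK, hIJ, h61'⟩ := h61 C_H hCH
  refine ⟨C, K, F, I, J, hK, hIJ, fun ε hε => ?_⟩
  filter_upwards [h61' ε hε, h72'] with x hx61 hx72
  obtain ⟨B, hB, hBx, hH⟩ := hx72
  refine ⟨B, hB, hBx, fun k L X R hCk hk hadm hnd hcoef hX1 hX2 hR1 hR2 => ?_⟩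
  obtain ⟨h1, h2, h3, h4, h5⟩ := hx61 B hB hBx k L X R hCk hk hadm hnd hcoef hX1 hX2 hR1 hR2
  refine ⟨h1, h2, fun i hcop hRi => h3 i hcop hRi ?_, h4, h5⟩
  have hX0 : 0 ≤ X := le_trans (by positivity) hX1
  have hR0 : 0 ≤ R := le_trans (Real.rpow_nonneg hX0 _) hR1
  refine hH k (L i) X hk (hadm.1 i) (FGKMT2018.intGcd_eq_one_of_formsAdmissible hadm i)
    (hcoef i).1 (hcoef i).2 hX1 hX2 (fun n hn => ?_) hcop
  have := hRi n hn
  exact_mod_cast hR0.trans this.le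

end Literature.NumberTheory.Sieve
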